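import Mathlib
import HarnessLib
import Summits.KontsevichZagierPeriods.KontsevichZagierPeriods.Theorems.MzvKernelInKZTwoPosetsCubicalChart
import Summits.KontsevichZagierPeriods.KontsevichZagierPeriods.Theorems.FurushoPentagonHoffmanRelationInKZCubicalTransportAux
import Summits.KontsevichZagierPeriods.KontsevichZagierPeriods.Theorems.LinRedNormalFormDihedralNormalFormStubNonSimpleReductionAux2

/-!
# Dihedral reflection of cubical atoms, III: the maps `C`, `C⁻¹`, `σ`

Sequel of `…StubNonSimpleReductionAux2` (crux `DihedralNormalForm`, stmt-KontsevichZagierPeriods-3912,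
line `torus-descent-sum-shadow`, stub `stub_nonSimpleReduction`). The reflection `S = C⁻¹ ∘ σ ∘ C` of
the open cube — `C` the cubical chart `tᵢ = x₀⋯xᵢ` onto the open ordered simplex
(`TwoPosets.cubicalMap`, transported by `monomialChart_transport`), `σ(t)ᵢ = 1 - t_{k-1-i}` the
affine involution of the simplex, `C⁻¹(t)ᵢ = tᵢ/t_{i-1}` — is realised (in part IV) as three
`KZ.changeOfVariablesRel` moves, giving `dihedralReflection_of_nonneg`: an atom
`[□ᵏ, q·xᵃ·∏(1 - x_I)^{e_I}]` is congruent modulo `KZ.relations` to the atom with the reflected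
exponents (`a' l = (k-1-l) + Σ_{I ⊆ [0,k-1-l]} e_I`, `e' i j = e (k-j) (k-i)` for `i ≥ 1`,
`e' 0 j = a(k-1-j) − [j ≥ 1](a(k-j) + 1 + Σ_{q ≥ k-j} e (k-j) q)`), under the hypothesis `a' ≥ 0`
(a consequence of absolute convergence — Brown's criterion — not proved here). As in parts I–II the
maps `σ`, `C⁻¹` and the exponent data are variables with defining hypotheses until the final theorem.
This part: `C`, `C⁻¹`, `σ` on the open cube / open ordered simplex, their semialgebraicity, the
derivative and determinant of `σ`, and the partial products of the reflected point `C⁻¹(σ(C y))`.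
-/

noncomputable section

namespace Summit.KontsevichZagierPeriods.DihedralNormalForm.TorusDescent

open Finset Real Set MeasureTheory MvPolynomial
open Literature.NumberTheory.Transcendental
open Summit.KontsevichZagierPeriods.MzvKernelInKZ.TwoPosets (cube pprod cubicalMap image_cubicalMap
  injOn_cubicalMap isSemialgebraic_cube prod_prod_erase_filter_le jacobian_pos cubicalMap_mem_simplex)
open Summit.KontsevichZagierPeriods.MzvKernelInKZ.Negative (simplex simplex_eq_openOrderedSimplex)
open Summit.KontsevichZagierPeriods.FurushoPentagon.HoffmanRelationInKZ (monomialChart_transport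
  hasFDerivAt_monomialChart det_monomialChart)

variable {k : ℕ}
variable (T : ℕ → (Fin k → ℝ) → ℝ) (I : Fin k → Fin k → (Fin k → ℝ) → ℝ)
  (A : (Fin k → ℕ) → (Fin k → Fin k → ℤ) → (Fin k → ℝ) → ℝ) (τ : Fin k → Fin k)
  (E0 : (Fin k → ℕ) → (Fin k → Fin k → ℤ) → Fin k → ℤ) (E1 : (Fin k → Fin k → ℤ) → Fin k → Fin k → ℤ)
  (eP : (Fin k → ℕ) → (Fin k → Fin k → ℤ) → Fin k → Fin k → ℤ) (AF : (Fin k → Fin k → ℤ) → Fin k → ℤ)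
  (σ Cinv : (Fin k → ℝ) → (Fin k → ℝ))

/-! ### The cubical chart, its inverse, and the simplex reflection -/

/-- The cubical chart in terms of `T`: `(C x)_i = T (i+1) x`. -/
theorem cubicalMap_eq_T
    (hT : ∀ (m : ℕ) (x : Fin k → ℝ), T m x = ∏ j : Fin k, if (j : ℕ) < m then x j else 1)
    (x : Fin k → ℝ) (i : Fin k) : cubicalMap k x i = T ((i : ℕ) + 1) x := by
  show pprod x i = _
  unfold pprod
  rw [hT, Finset.prod_filter]
  refine Finset.prod_congr rfl fun j _ => ?_
  have : (j ≤ i) ↔ ((j : ℕ) < (i : ℕ) + 1) := by rw [Fin.le_def]; omega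
  rw [if_congr this rfl rfl]

/-- `σ` is an involution. -/
theorem σ_σ (hσ : ∀ (t : Fin k → ℝ) (i : Fin k), σ t i = 1 - t (Fin.rev i)) (t : Fin k → ℝ) :
    σ (σ t) = t := by
  funext i; rw [hσ, hσ, Fin.rev_rev]; ring

/-- `σ` maps the open ordered simplex to itself. -/
theorem σ_mem_simplex (hσ : ∀ (t : Fin k → ℝ) (i : Fin k), σ t i = 1 - t (Fin.rev i))
    {t : Fin k → ℝ} (ht : t ∈ simplex k) : σ t ∈ simplex k := by
  obtain ⟨h0, h1, hanti⟩ := ht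
  refine ⟨fun i => ?_, fun i => ?_, fun i j hij => ?_⟩
  · rw [hσ]; exact sub_pos.mpr (h1 _)
  · rw [hσ]; exact sub_lt_self _ (h0 _)
  · rw [hσ, hσ]
    have : Fin.rev j < Fin.rev i := Fin.rev_lt_rev.mpr hij
    linarith [hanti this]

/-- `σ '' simplex = simplex`. -/
theorem image_σ_simplex (hσ : ∀ (t : Fin k → ℝ) (i : Fin k), σ t i = 1 - t (Fin.rev i)) :
    σ '' simplex k = simplex k := by
  apply Set.Subset.antisymm
  · rintro _ ⟨t, ht, rfl⟩; exact σ_mem_simplex σ hσ ht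
  · intro t ht; exact ⟨σ t, σ_mem_simplex σ hσ ht, σ_σ σ hσ t⟩

/-- Partial products of the inverse chart recover the simplicial coordinates:
`T (i+1) (C⁻¹ t) = t_i` (off the coordinate hyperplanes). -/
theorem T_succ_Cinv
    (hT : ∀ (m : ℕ) (x : Fin k → ℝ), T m x = ∏ j : Fin k, if (j : ℕ) < m then x j else 1)
    (hCinv : ∀ (t : Fin k → ℝ) (i : Fin k), Cinv t i =
      t i / (if (i : ℕ) = 0 then 1 else t ⟨(i : ℕ) - 1, lt_of_le_of_lt (Nat.sub_le _ _) i.isLt⟩))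
    {t : Fin k → ℝ} (ht : ∀ i, t i ≠ 0) (i : Fin k) : T ((i : ℕ) + 1) (Cinv t) = t i := by
  suffices h : ∀ m : ℕ, ∀ hm : m < k, T (m + 1) (Cinv t) = t ⟨m, hm⟩ from h i i.isLt
  intro m
  induction m with
  | zero =>
    intro hm
    rw [T_succ T hT, T_zero T hT, one_mul, dif_pos hm, hCinv]
    simp
  | succ m ih =>
    intro hm
    rw [T_succ T hT, ih (by omega), dif_pos hm, hCinv]
    simp only [Nat.add_eq_zero_iff, one_ne_zero, and_false, ↓reduceIte, Nat.add_sub_cancel]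
    rw [mul_div_cancel₀ _ (ht _)]

/-- `C (C⁻¹ t) = t` off the coordinate hyperplanes. -/
theorem cubicalMap_Cinv
    (hT : ∀ (m : ℕ) (x : Fin k → ℝ), T m x = ∏ j : Fin k, if (j : ℕ) < m then x j else 1)
    (hCinv : ∀ (t : Fin k → ℝ) (i : Fin k), Cinv t i =
      t i / (if (i : ℕ) = 0 then 1 else t ⟨(i : ℕ) - 1, lt_of_le_of_lt (Nat.sub_le _ _) i.isLt⟩))
    {t : Fin k → ℝ} (ht : ∀ i, t i ≠ 0) : cubicalMap k (Cinv t) = t := by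
  funext i; rw [cubicalMap_eq_T T hT, T_succ_Cinv T Cinv hT hCinv ht]

/-- `C⁻¹ (C x) = x` off the coordinate hyperplanes. -/
theorem Cinv_cubicalMap
    (hT : ∀ (m : ℕ) (x : Fin k → ℝ), T m x = ∏ j : Fin k, if (j : ℕ) < m then x j else 1)
    (hCinv : ∀ (t : Fin k → ℝ) (i : Fin k), Cinv t i =
      t i / (if (i : ℕ) = 0 then 1 else t ⟨(i : ℕ) - 1, lt_of_le_of_lt (Nat.sub_le _ _) i.isLt⟩))
    {x : Fin k → ℝ} (hx : ∀ i, x i ≠ 0) : Cinv (cubicalMap k x) = x := by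
  funext i
  rw [hCinv, cubicalMap_eq_T T hT]
  have hTi : T (i : ℕ) x ≠ 0 := by
    rw [hT]; exact Finset.prod_ne_zero_iff.mpr fun j _ => by split_ifs; exacts [hx j, one_ne_zero]
  split_ifs with hi
  · rw [div_one, T_succ_eq_mul T hT, hi]
    simp [T_zero T hT]
  · rw [cubicalMap_eq_T T hT]
    have : T ((⟨(i : ℕ) - 1, lt_of_le_of_lt (Nat.sub_le _ _) i.isLt⟩ : Fin k) + 1) x =
        T (i : ℕ) x := by
      congr 1; simp only; omega
    rw [this, T_succ_eq_mul T hT, mul_div_cancel_left₀ _ hTi]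

/-- `C⁻¹` maps the open ordered simplex into the open cube. -/
theorem Cinv_mem_cube
    (hCinv : ∀ (t : Fin k → ℝ) (i : Fin k), Cinv t i =
      t i / (if (i : ℕ) = 0 then 1 else t ⟨(i : ℕ) - 1, lt_of_le_of_lt (Nat.sub_le _ _) i.isLt⟩))
    {t : Fin k → ℝ} (ht : t ∈ simplex k) : ∀ i, Cinv t i ∈ Set.Ioo (0 : ℝ) 1 := by
  obtain ⟨h0, h1, hanti⟩ := ht
  intro i
  rw [hCinv]
  split_ifs with hi
  · rw [div_one]; exact ⟨h0 i, h1 i⟩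
  · have hlt : t i < t ⟨(i : ℕ) - 1, lt_of_le_of_lt (Nat.sub_le _ _) i.isLt⟩ :=
      hanti (Fin.lt_def.mpr (by simp only; omega))
    exact ⟨div_pos (h0 _) (h0 _), (div_lt_one (h0 _)).mpr hlt⟩

/-- The reflected point `z = C⁻¹ (σ (C y))`: its partial products are `T m z = 1 - T (k+1-m) y`. -/
theorem T_reflected
    (hT : ∀ (m : ℕ) (x : Fin k → ℝ), T m x = ∏ j : Fin k, if (j : ℕ) < m then x j else 1)
    (hσ : ∀ (t : Fin k → ℝ) (i : Fin k), σ t i = 1 - t (Fin.rev i))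
    (hCinv : ∀ (t : Fin k → ℝ) (i : Fin k), Cinv t i =
      t i / (if (i : ℕ) = 0 then 1 else t ⟨(i : ℕ) - 1, lt_of_le_of_lt (Nat.sub_le _ _) i.isLt⟩))
    {y : Fin k → ℝ} (hy : ∀ i, y i ∈ Set.Ioo (0 : ℝ) 1) (m : ℕ) (hm1 : 1 ≤ m) (hmk : m ≤ k) :
    T m (Cinv (σ (cubicalMap k y))) = 1 - T (k + 1 - m) y := by
  have hne : ∀ i, σ (cubicalMap k y) i ≠ 0 := by
    cases k with
    | zero => intro i; exact i.elim0
    | succ n =>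
      have hs := σ_mem_simplex σ hσ (cubicalMap_mem_simplex (show y ∈ cube (n + 1) from hy))
      exact fun i => (hs.1 i).ne'
  obtain ⟨m', rfl⟩ : ∃ m', m = m' + 1 := ⟨m - 1, by omega⟩
  rw [T_succ_Cinv T Cinv hT hCinv hne ⟨m', by omega⟩, hσ, cubicalMap_eq_T T hT, Fin.val_rev]
  show 1 - T (k - (m' + 1) + 1) y = 1 - T (k + 1 - (m' + 1)) y
  congr 2; omega

/-- `∏ᵢ t_{i-1} = ∏ⱼ (C⁻¹ t)ⱼ^{k-1-j}` (the Jacobian at the preimage) off the hyperplanes. -/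
theorem prod_prev_eq_jac
    (hT : ∀ (m : ℕ) (x : Fin k → ℝ), T m x = ∏ j : Fin k, if (j : ℕ) < m then x j else 1)
    (hCinv : ∀ (t : Fin k → ℝ) (i : Fin k), Cinv t i =
      t i / (if (i : ℕ) = 0 then 1 else t ⟨(i : ℕ) - 1, lt_of_le_of_lt (Nat.sub_le _ _) i.isLt⟩))
    {t : Fin k → ℝ} (ht : ∀ i, t i ≠ 0) :
    (∏ i : Fin k, (if (i : ℕ) = 0 then (1 : ℝ) else
        t ⟨(i : ℕ) - 1, lt_of_le_of_lt (Nat.sub_le _ _) i.isLt⟩)) =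
      ∏ j : Fin k, (Cinv t) j ^ (k - 1 - (j : ℕ)) := by
  rw [← prod_T_eq_prod_pow T hT]
  refine Finset.prod_congr rfl fun i _ => ?_
  by_cases hi : (i : ℕ) = 0
  · rw [if_pos hi, if_pos hi]
  · rw [if_neg hi, if_neg hi]
    have := T_succ_Cinv T Cinv hT hCinv ht ⟨(i : ℕ) - 1, lt_of_le_of_lt (Nat.sub_le _ _) i.isLt⟩
    have h2 : (((⟨(i : ℕ) - 1, lt_of_le_of_lt (Nat.sub_le _ _) i.isLt⟩ : Fin k) : ℕ) + 1) =
        (i : ℕ) := by simp only; omega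
    rw [h2] at this
    rw [this]

/-! ### Semialgebraicity, derivative and determinant -/

/-- The simplex is `ℚ`-semialgebraic. -/
theorem isSemialgebraic_simplex (k : ℕ) :
    Literature.ModelTheory.ExponentialFields.IsSemialgebraic ℚ (simplex k) := by
  rw [simplex_eq_openOrderedSimplex]; exact KZ.isSemialgebraic_openOrderedSimplex k

/-- The inverse cubical chart is a `ℚ`-semialgebraic map on the simplex. -/
theorem isSemialgebraicMapOn_Cinv
    (hCinv : ∀ (t : Fin k → ℝ) (i : Fin k), Cinv t i =
      t i / (if (i : ℕ) = 0 then 1 else t ⟨(i : ℕ) - 1, lt_of_le_of_lt (Nat.sub_le _ _) i.isLt⟩)) :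
    IsSemialgebraicMapOn ℚ (simplex k) Cinv := by
  refine IsSemialgebraicMapOn.of_forall (isSemialgebraic_simplex k) fun j => ?_
  by_cases hj : (j : ℕ) = 0
  · refine (isSemialgebraicFunOn_aeval_div_aeval (isSemialgebraic_simplex k) (X j) 1
      (fun t _ => by simp)).congr fun t _ => ?_
    rw [hCinv]; simp [hj]
  · refine (isSemialgebraicFunOn_aeval_div_aeval (isSemialgebraic_simplex k) (X j)
      (X ⟨(j : ℕ) - 1, lt_of_le_of_lt (Nat.sub_le _ _) j.isLt⟩) (fun t ht => ?_)).congr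
      fun t _ => ?_
    · simp only [aeval_X]; exact (ht.1 _).ne'
    · rw [hCinv]; simp [hj]

/-- `t ↦ 1 / ∏ᵢ t_{i-1}` is a `ℚ`-semialgebraic function on the simplex. -/
theorem isSemialgebraicFunOn_invJac (k : ℕ) : IsSemialgebraicFunOn ℚ (simplex k)
    (fun (t : Fin k → ℝ) => (∏ i : Fin k, (if (i : ℕ) = 0 then (1 : ℝ) else
      t ⟨(i : ℕ) - 1, lt_of_le_of_lt (Nat.sub_le _ _) i.isLt⟩))⁻¹) := by
  classical
  let P : Fin k → MvPolynomial (Fin k) ℚ := fun i =>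
    if (i : ℕ) = 0 then 1 else X ⟨(i : ℕ) - 1, lt_of_le_of_lt (Nat.sub_le _ _) i.isLt⟩
  have hP : ∀ t : Fin k → ℝ, ∀ i, aeval t (P i) = (if (i : ℕ) = 0 then (1 : ℝ) else
      t ⟨(i : ℕ) - 1, lt_of_le_of_lt (Nat.sub_le _ _) i.isLt⟩) := by
    intro t i
    simp only [P]
    split_ifs <;> simp
  have hprod : ∀ t : Fin k → ℝ, aeval t (∏ i, P i) = ∏ i : Fin k, (if (i : ℕ) = 0 then (1 : ℝ)
      else t ⟨(i : ℕ) - 1, lt_of_le_of_lt (Nat.sub_le _ _) i.isLt⟩) := by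
    intro t; rw [map_prod]; exact Finset.prod_congr rfl fun i _ => hP t i
  refine (isSemialgebraicFunOn_aeval_div_aeval (isSemialgebraic_simplex k) 1 (∏ i, P i)
    (fun t ht => ?_)).congr fun t _ => ?_
  · rw [hprod]
    exact Finset.prod_ne_zero_iff.mpr fun i _ => by split_ifs; exacts [one_ne_zero, (ht.1 _).ne']
  · show aeval t 1 / aeval t (∏ i, P i) = _
    rw [hprod, map_one, one_div]

/-- `σ` is a `ℚ`-semialgebraic map on the simplex. -/
theorem isSemialgebraicMapOn_σ (hσ : ∀ (t : Fin k → ℝ) (i : Fin k), σ t i = 1 - t (Fin.rev i)) :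
    IsSemialgebraicMapOn ℚ (simplex k) σ :=
  (isSemialgebraicMapOn_aeval (isSemialgebraic_simplex k) (fun i => 1 - X (Fin.rev i))).congr
    fun t _ => by funext i; rw [hσ]; simp

/-- `σ` is differentiable, with derivative the "minus reversal" continuous linear map. -/
theorem hasFDerivAt_σ (hσ : ∀ (t : Fin k → ℝ) (i : Fin k), σ t i = 1 - t (Fin.rev i))
    (t : Fin k → ℝ) : HasFDerivAt σ (ContinuousLinearMap.pi fun i : Fin k =>
      -(ContinuousLinearMap.proj (R := ℝ) (φ := fun _ : Fin k => ℝ) (Fin.rev i))) t := by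
  have hσ_eq : σ = fun t => (fun _ => (1 : ℝ)) + (ContinuousLinearMap.pi fun i : Fin k =>
      -(ContinuousLinearMap.proj (R := ℝ) (φ := fun _ : Fin k => ℝ) (Fin.rev i))) t := by
    funext t i
    rw [hσ]
    simp [sub_eq_neg_add, add_comm]
  rw [hσ_eq]
  exact (ContinuousLinearMap.hasFDerivAt _).const_add _

/-- The "minus reversal" map is an involution, so its determinant has absolute value `1`. -/
theorem abs_det_minusRev (k : ℕ) : |(ContinuousLinearMap.pi fun i : Fin k =>
      -(ContinuousLinearMap.proj (R := ℝ) (φ := fun _ : Fin k => ℝ) (Fin.rev i))).det| = 1 := by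
  set L : (Fin k → ℝ) →L[ℝ] (Fin k → ℝ) := ContinuousLinearMap.pi fun i : Fin k =>
      -(ContinuousLinearMap.proj (R := ℝ) (φ := fun _ : Fin k => ℝ) (Fin.rev i)) with hL
  have hcomp : (L : (Fin k → ℝ) →ₗ[ℝ] (Fin k → ℝ)) ∘ₗ (L : (Fin k → ℝ) →ₗ[ℝ] (Fin k → ℝ)) =
      LinearMap.id := by
    apply LinearMap.ext
    intro v
    funext i
    simp [hL, Fin.rev_rev]
  have h1 : L.det * L.det = 1 := by
    have := congrArg LinearMap.det hcomp
    rw [LinearMap.det_comp, LinearMap.det_id] at this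
    exact this
  rcases mul_self_eq_one_iff.mp h1 with h | h <;> simp [h]

/-- `σ` is injective on the simplex. -/
theorem injOn_σ (hσ : ∀ (t : Fin k → ℝ) (i : Fin k), σ t i = 1 - t (Fin.rev i)) :
    InjOn σ (simplex k) := by
  intro s _ t _ h
  have := congrArg σ h
  rwa [σ_σ σ hσ, σ_σ σ hσ] at this

/-! ### Registered sub-goal -/

/-- Registered sub-goal `stub_nonSimpleReductionAux3`: the simplex reflection `t ↦ 𝟙 - t^{rev}` maps
the open ordered simplex onto itself (closed form of `image_σ_simplex`). -/
theorem stub_nonSimpleReductionAux3 : ∀ (k : ℕ), (fun (t : Fin k → ℝ) (i : Fin k) => 1 - t (Fin.rev i)) '' {t : Fin k → ℝ | (∀ i, 0 < t i) ∧ (∀ i, t i < 1) ∧ StrictAnti t} = {t : Fin k → ℝ | (∀ i, 0 < t i) ∧ (∀ i, t i < 1) ∧ StrictAnti t} :=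
  fun _ => image_σ_simplex (fun t i => 1 - t (Fin.rev i)) (fun _ _ => rfl)

end Summit.KontsevichZagierPeriods.DihedralNormalForm.TorusDescent
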